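import Summits.ABC.ABC.Theses.DefiniteXi
import Summits.ABC.ABC.Theorems.DefiniteXiSteinbergCoreXi10Assembly
import Summits.ABC.ABC.Theorems.DefiniteXiFreyModularityIsModular
import Literature.NumberTheory.EllipticCurves.CongruenceNumber

/-!
# STUB-IDEAS k1 · gen 47 — by-name sanity of the helper lemmas for `stub_xiDegreeComparison`
(crux `DefiniteXi.SteinbergCore`, stmt-ABC-15024, line `p6_tamagawa_split`, skeleton sha cda023e8)

Planner seat (stub-ideation): statements + one-line by-name closures only; tree imports only.
S1a = one-sided Frey valuation inequality (⟸ ARS 2012 Thm 2.1(b) named fact);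
S1b = `DefiniteXi.FreyModularity` (item stmt-ABC-11340) by name (⟸ BCDT `CDT_theorem_7_1_2` named fact);
assembly = Xi10 `stub_xiDegreeComparison_of_oneSided` / `_of_facts`.
-/

set_option linter.dupNamespace false
set_option autoImplicit false

noncomputable section

namespace Summit.ABC.ABC.Cruxes.SteinbergCore.StubIdeasK1G47

open Literature.NumberTheory.EllipticCurves Literature.NumberTheory.EllipticCurves.ModularForms
open Literature.NumberTheory.Automorphic

/-- The registered stub header, verbatim (`Lines/p6_tamagawa_split.lean`, `stub_xiDegreeComparison`). -/
def StubSig : Prop :=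
    ∀ ε : ℝ, 0 < ε → ∃ C : ℝ, ∀ a b : ℤ, IsCoprime a b → a * b * (a + b) ≠ 0 → ∀ (N : ℕ) [NeZero N],
      (Literature.NumberTheory.EllipticCurves.freyCurve a b).conductorNorm ℤ = N →
      ∀ Nm : ℕ, Odd Nm → Squarefree Nm → Odd Nm.primeFactors.card → Nm ∣ N →
      Literature.NumberTheory.Automorphic.brandtXi (N / Nm) Nm
          (fun n => (Literature.NumberTheory.EllipticCurves.freyCurve a b).LFunction n) ≠ 0 →
      ∃ D : Literature.NumberTheory.EllipticCurves.ModularForms.ModularParametrizationData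
        (Literature.NumberTheory.EllipticCurves.freyCurve a b) N,
        (∀ D' : Literature.NumberTheory.EllipticCurves.ModularForms.ModularParametrizationData
          (Literature.NumberTheory.EllipticCurves.freyCurve a b) N, D.deg ≤ D'.deg) ∧
        ((Literature.NumberTheory.Automorphic.brandtXi (N / Nm) Nm
              (fun n => (Literature.NumberTheory.EllipticCurves.freyCurve a b).LFunction n) /
            (ordProj[2] (Literature.NumberTheory.Automorphic.brandtXi (N / Nm) Nm
                (fun n => (Literature.NumberTheory.EllipticCurves.freyCurve a b).LFunction n)) *
              ordProj[3] (Literature.NumberTheory.Automorphic.brandtXi (N / Nm) Nm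
                (fun n => (Literature.NumberTheory.EllipticCurves.freyCurve a b).LFunction n))) : ℕ) : ℝ) ≤
          C * (N : ℝ) ^ ε * ((D.deg / (ordProj[2] D.deg * ordProj[3] D.deg) : ℕ) : ℝ) *
            ((∏ q ∈ N.primeFactors, ((Literature.NumberTheory.EllipticCurves.freyCurve a b).minimalDiscriminantNorm
              ℤ).factorization q : ℕ) : ℝ) ^ 3

/-- Helper S1a (signature): the one-sided Frey valuation inequality `v_p r_(D.f) ≤ v_p deg φ_D`, `p ≥ 5`. -/
def SigOneSidedFrey : Prop :=
  ∀ (a b : ℤ), IsCoprime a b → a * b * (a + b) ≠ 0 → ∀ (N : ℕ) [NeZero N], (freyCurve a b).conductorNorm ℤ = N →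
    ∀ (D : ModularParametrizationData (freyCurve a b) N) (p : ℕ), p.Prime → 5 ≤ p →
      padicValNat p (congruenceNumber D.f) ≤ padicValNat p D.modularDegree

/-- Helper S1b (signature, BY NAME = item stmt-ABC-11340). -/
def SigFreyModularity : Prop := Summit.ABC.ABC.Theses.DefiniteXi.FreyModularity

/-- S1a from the ARS named fact: ONE line (helper H4 of Xi8). -/
theorem s1a_of_ARS (hARS : padicValNat_congruenceNumber_eq_of_not_sq_dvd) : SigOneSidedFrey :=
  fun _a _b hab h0 _N _ hN D _p hp h5 =>
    Summit.ABC.ABC.Theorems.SteinbergCoreXi.StubIdeasK1G11.padicValNat_congruenceNumber_le_padicValNat_deg_of_frey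
      hARS hab h0 hN D hp h5

/-- S1b from the BCDT named fact: ONE line (landed `freyModularity_of_CDT_theorem_7_1_2'`). -/
theorem s1b_of_CDT (h712 : BCDT.CDT_theorem_7_1_2) : SigFreyModularity :=
  Summit.ABC.ABC.Theorems.freyModularity_of_CDT_theorem_7_1_2' h712

/-- ASSEMBLY: helpers ⇒ registered stub text, by name (Xi10). -/
theorem stub_of_helpers (h1 : SigOneSidedFrey) (h2 : SigFreyModularity) : StubSig :=
  Summit.ABC.ABC.Theorems.SteinbergCoreXi.StubIdeasK1G11.stub_xiDegreeComparison_of_oneSided h1 h2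

/-- ASSEMBLY from the two named facts (ARS 2.1(b), BCDT 7.1.2): the registered stub text, axioms to be printed. -/
theorem stub_of_facts (hARS : padicValNat_congruenceNumber_eq_of_not_sq_dvd) (h712 : BCDT.CDT_theorem_7_1_2) :
    StubSig :=
  stub_of_helpers (s1a_of_ARS hARS) (s1b_of_CDT h712)

end Summit.ABC.ABC.Cruxes.SteinbergCore.StubIdeasK1G47

end
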